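import Summits.Ventures.CertifiedManyBodySolver.Theses.TcThermcert1
import Summits.Ventures.CertifiedManyBodySolver.Observables.RungLeavesStiffnessAnchor

/-!
# Sketch — crux-ideate seat -4 g0 on `stmt-Ventures-24560` (K1′ = `ThermalStiffnessCeilingU8b8_le_7o44`)
Idea `cold-transport-drude-ceiling`: move K1′ from the (host-dead) β·t = 8 thermal word certification to the
GROUND-STATE stiffness programme through ONE finite-volume inequality T (twist free-energy cost at T = t/8 ≤ twist
ground-energy cost, pointwise in θ, eventually in L).  First lemma PROVED here (0 sorry): T ∧ (dual GS ceiling 7/44) → K1′.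
-/

noncomputable section

namespace Summit.Ventures.CertifiedManyBodySolver.Cruxes.ThermalStiffnessCeilingU8b8_le_7o44.ColdTransport

open Filter Topology
open Literature.MathematicalPhysics.QuantumLattice
open Summit.Ventures.CertifiedManyBodySolver.Observables
open Summit.Ventures.CertifiedManyBodySolver.Theses.TcThermcert1

/-- **T — cold transport of the twist cost at `(t′, U, n, β)`** (pointwise in `θ`, eventually along every `L_j → ∞`):
`(log Z_{L}(β,0) − log Z_{L}(β,θ))/β ≤ E_L(θ) − E_L(0) + ε θ²` — the sector free-energy cost of a total seam flux `θ` at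
temperature `1/β` never exceeds (asymptotically) its ground-state energy cost.  Physics: `Υ_L(T) ≤ D_L(0)` (stiffness does not
increase on heating; Drude ≥ superfluid weight).  No clustering / analyticity / uniqueness content; survives `T_KT > t/8`. -/
def TwistCostColdTransportAt (tp U n β : ℝ) : Prop :=
  ∀ ε : ℝ, 0 < ε → ∃ θ₁ : ℝ, 0 < θ₁ ∧ ∀ θ : ℝ, 0 < |θ| → |θ| ≤ θ₁ →
    ∀ Ls : ℕ → ℕ, Tendsto Ls atTop atTop →
      ∀ᶠ j in atTop, ∀ [NeZero (Ls j)],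
        (thermalFluxLogZ (Ls j) tp U (1 - n) β 0 - thermalFluxLogZ (Ls j) tp U (1 - n) β θ) / β
          ≤ fluxEnergyTT' (Ls j) tp U (1 - n) θ - fluxEnergyTT' (Ls j) tp U (1 - n) 0 + ε * θ ^ 2

/-- **Dual (certificate-shaped) ground-state twist-cost ceiling `c`**: `E_L(θ) − E_L(0) ≤ (c + ε) θ²` pointwise in small `θ ≠ 0`,
eventually along every `L_j → ∞`.  This is what a `T = 0` trial-generator / variational certificate proves; it implies the tree's
GS leaf `ObsStiffnessSeqCeilingAt tp U n c` (`groundDual_implies_leaf`). -/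
def GroundTwistCostSeqCeilingAt (tp U n : ℝ) (c : ℚ) : Prop :=
  ∀ ε : ℝ, 0 < ε → ∃ θ₁ : ℝ, 0 < θ₁ ∧ ∀ θ : ℝ, 0 < |θ| → |θ| ≤ θ₁ →
    ∀ Ls : ℕ → ℕ, Tendsto Ls atTop atTop →
      ∀ᶠ j in atTop, ∀ [NeZero (Ls j)],
        fluxEnergyTT' (Ls j) tp U (1 - n) θ - fluxEnergyTT' (Ls j) tp U (1 - n) 0 ≤ (((c : ℚ) : ℝ) + ε) * θ ^ 2

/-- FIRST LEMMA (statement): transport + GS dual ceiling `7/44` ⇒ K1′. -/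
def FirstLemma : Prop :=
  TwistCostColdTransportAt 0 8 (7 / 8) 8 → GroundTwistCostSeqCeilingAt 0 8 (7 / 8) (7 / 44) →
    ThermalStiffnessCeilingU8b8_le_7o44

/-- FIRST LEMMA, proved (pure bookkeeping: pick one admissible `θ`, one large `j`). -/
theorem firstLemma : FirstLemma := by
  intro hT hG ρs θ₀ hρs hθ₀ Ls hLs hprem
  refine le_of_forall_pos_le_add (fun δ hδ => ?_)
  obtain ⟨θ₁, hθ₁, hT'⟩ := hT (δ / 4) (by positivity)
  obtain ⟨θ₂, hθ₂, hG'⟩ := hG (δ / 4) (by positivity)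
  set θ : ℝ := min θ₀ (min θ₁ θ₂) with hθdef
  have hθpos : 0 < θ := lt_min hθ₀ (lt_min hθ₁ hθ₂)
  have hθabs : |θ| = θ := abs_of_pos hθpos
  have hθ0 : |θ| ≤ θ₀ := by rw [hθabs]; exact min_le_left _ _
  have hθ1 : |θ| ≤ θ₁ := by rw [hθabs]; exact (min_le_right _ _).trans (min_le_left _ _)
  have hθ2 : |θ| ≤ θ₂ := by rw [hθabs]; exact (min_le_right _ _).trans (min_le_right _ _)
  have hθa : 0 < |θ| := by rw [hθabs]; exact hθpos
  have h1 := hT' θ hθa hθ1 Ls hLs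
  have h2 := hG' θ hθa hθ2 Ls hLs
  have h3 : ∀ᶠ j in atTop, 1 ≤ Ls j := hLs.eventually_ge_atTop 1
  obtain ⟨j, hj1, hj2, hj3⟩ := (h1.and (h2.and h3)).exists
  haveI : NeZero (Ls j) := ⟨by omega⟩
  have e1 :
      (thermalFluxLogZ (Ls j) 0 8 (1 - 7 / 8) 8 0 - thermalFluxLogZ (Ls j) 0 8 (1 - 7 / 8) 8 θ) / 8
        ≤ fluxEnergyTT' (Ls j) 0 8 (1 - 7 / 8) θ - fluxEnergyTT' (Ls j) 0 8 (1 - 7 / 8) 0 + δ / 4 * θ ^ 2 := hj1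
  have e2 :
      fluxEnergyTT' (Ls j) 0 8 (1 - 7 / 8) θ - fluxEnergyTT' (Ls j) 0 8 (1 - 7 / 8) 0
        ≤ ((((7 / 44 : ℚ)) : ℝ) + δ / 4) * θ ^ 2 := hj2
  have hp := hprem j θ hθ0
  have hsq : 0 < θ ^ 2 := by positivity
  have key : ρs * θ ^ 2 ≤ ((((7 / 44 : ℚ)) : ℝ) + δ / 2) * θ ^ 2 := by nlinarith
  have : ρs ≤ (((7 / 44 : ℚ)) : ℝ) + δ / 2 := le_of_mul_le_mul_right key hsq
  linarith

/-- The dual GS ceiling implies the tree's ground-state stiffness leaf (so it is a legitimate GS-programme target). -/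
theorem groundDual_implies_leaf {tp U n : ℝ} {c : ℚ} (hG : GroundTwistCostSeqCeilingAt tp U n c) :
    ObsStiffnessSeqCeilingAt tp U n c := by
  intro ρs θ₀ hρs hθ₀ Ls hLs hprem
  refine le_of_forall_pos_le_add (fun δ hδ => ?_)
  obtain ⟨θ₁, hθ₁, hG'⟩ := hG (δ / 2) (by positivity)
  set θ : ℝ := min θ₀ θ₁ with hθdef
  have hθpos : 0 < θ := lt_min hθ₀ hθ₁
  have hθabs : |θ| = θ := abs_of_pos hθpos
  have hθ0 : |θ| ≤ θ₀ := by rw [hθabs]; exact min_le_left _ _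
  have hθ1 : |θ| ≤ θ₁ := by rw [hθabs]; exact min_le_right _ _
  have hθa : 0 < |θ| := by rw [hθabs]; exact hθpos
  have h2 := hG' θ hθa hθ1 Ls hLs
  have h3 : ∀ᶠ j in atTop, 1 ≤ Ls j := hLs.eventually_ge_atTop 1
  obtain ⟨j, hj2, hj3⟩ := (h2.and h3).exists
  haveI : NeZero (Ls j) := ⟨by omega⟩
  have e2 : fluxEnergyTT' (Ls j) tp U (1 - n) θ - fluxEnergyTT' (Ls j) tp U (1 - n) 0 ≤ (((c : ℚ) : ℝ) + δ / 2) * θ ^ 2 :=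
    hj2
  have hp := hprem j θ hθ0
  have hsq : 0 < θ ^ 2 := by positivity
  have key : ρs * θ ^ 2 ≤ (((c : ℚ) : ℝ) + δ / 2) * θ ^ 2 := by nlinarith
  have : ρs ≤ ((c : ℚ) : ℝ) + δ / 2 := le_of_mul_le_mul_right key hsq
  linarith

/-! ## Splitting T into its physics residue T₁ (no reentrance between `t/8` and `t·L⁻³`) and a provable cold limit T₂ -/

/-- **T₁ — no reentrance between `β` and the algebraically cold `β_L = L³`** (the ONLY physics input of the line):
`ΔF_L(β,θ) ≤ ΔF_L(L³,θ) + εθ²` pointwise in small `θ ≠ 0`, eventually along every `L_j → ∞` (`ΔF_L(β,θ) := (log Z_L(β,0) − log Z_L(β,θ))/β`).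
Reading: the finite-torus helicity modulus does not DEcrease on cooling from `T = 1/β` to `T = L⁻³`. -/
def TwistCostNoReentranceAt (tp U n β : ℝ) : Prop :=
  ∀ ε : ℝ, 0 < ε → ∃ θ₁ : ℝ, 0 < θ₁ ∧ ∀ θ : ℝ, 0 < |θ| → |θ| ≤ θ₁ →
    ∀ Ls : ℕ → ℕ, Tendsto Ls atTop atTop →
      ∀ᶠ j in atTop, ∀ [NeZero (Ls j)],
        (thermalFluxLogZ (Ls j) tp U (1 - n) β 0 - thermalFluxLogZ (Ls j) tp U (1 - n) β θ) / β
          ≤ (thermalFluxLogZ (Ls j) tp U (1 - n) ((Ls j : ℝ) ^ 3) 0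
              - thermalFluxLogZ (Ls j) tp U (1 - n) ((Ls j : ℝ) ^ 3) θ) / ((Ls j : ℝ) ^ 3) + ε * θ ^ 2

/-- **T₂ — cold limit** (ATTACKABLE, finite-dimensional: `−βE₀ ≤ log Z_sector(β) ≤ −βE₀ + log dim`, `dim ≤ 4^{L²}`, so the slack is
`L² log 4 / L³ → 0 ≤ εθ²` eventually; tree tools `partitionFn_le_card_mul_exp`, `exp_neg_mul_minEnergyOn_le_re_trace_proj_gibbsWeight`
plus the identification of the `toBlock` sector with `szSector N_L 0`): `ΔF_L(L³,θ) ≤ E_L(θ) − E_L(0) + εθ²` eventually. -/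
def TwistCostColdLimitAt (tp U n : ℝ) : Prop :=
  ∀ ε : ℝ, 0 < ε → ∃ θ₁ : ℝ, 0 < θ₁ ∧ ∀ θ : ℝ, 0 < |θ| → |θ| ≤ θ₁ →
    ∀ Ls : ℕ → ℕ, Tendsto Ls atTop atTop →
      ∀ᶠ j in atTop, ∀ [NeZero (Ls j)],
        (thermalFluxLogZ (Ls j) tp U (1 - n) ((Ls j : ℝ) ^ 3) 0
            - thermalFluxLogZ (Ls j) tp U (1 - n) ((Ls j : ℝ) ^ 3) θ) / ((Ls j : ℝ) ^ 3)
          ≤ fluxEnergyTT' (Ls j) tp U (1 - n) θ - fluxEnergyTT' (Ls j) tp U (1 - n) 0 + ε * θ ^ 2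

/-- T ⟸ T₁ ∧ T₂ (bookkeeping, proved). -/
theorem transport_of_noReentrance_coldLimit {tp U n β : ℝ}
    (h1 : TwistCostNoReentranceAt tp U n β) (h2 : TwistCostColdLimitAt tp U n) :
    TwistCostColdTransportAt tp U n β := by
  intro ε hε
  obtain ⟨θ₁, hθ₁, h1'⟩ := h1 (ε / 2) (by positivity)
  obtain ⟨θ₂, hθ₂, h2'⟩ := h2 (ε / 2) (by positivity)
  refine ⟨min θ₁ θ₂, lt_min hθ₁ hθ₂, fun θ hθa hθle Ls hLs => ?_⟩
  have a := h1' θ hθa (hθle.trans (min_le_left _ _)) Ls hLs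
  have b := h2' θ hθa (hθle.trans (min_le_right _ _)) Ls hLs
  filter_upwards [a, b] with j hj1 hj2
  intro inst
  have e1 := @hj1 inst
  have e2 := @hj2 inst
  linarith

end Summit.Ventures.CertifiedManyBodySolver.Cruxes.ThermalStiffnessCeilingU8b8_le_7o44.ColdTransport
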